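import Summits.KontsevichZagierPeriods.KontsevichZagierPeriods.Cruxes.OffTetraSectorKernel.SketchIdeator2
import Literature.NumberTheory.Transcendental.GammaMonomialsProofs

/-!
# Drefute work file — crux `OffTetraSectorKernel` (stmt-KontsevichZagierPeriods-10557), line `flat-shadow`

Seat refuter-drefute-stmt-KontsevichZagierPeriods-10557-0, 2026-08-16. Audit of the registered stub set
`stub_invert`, `stub_descend`, `stub_offFlat` (skeleton sha 959be3b9526f): **0 stub-false, 0 stub-misstated,
3 survived** — see `DrefuteFlatShadow.md` next to this file. Everything below is kernel-checked (0 `sorry`)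
and importable by the lead:

* §1 set identities behind the two transfer stubs: `invertedSolid_eq_image` (`S z = Φ '' T(z)`, rule (2)
  domain clause), `injOn_inv3`, `powPoly_pos` (`P > 0` on the open triangle, barycentric identity
  `barycentric`), `invertedSolid_eq_band` (`S z` = open band under `b = (Im z / P)^{1/2}`, rule (3) shape),
  `half_sqrt_sq_eq_flatDensity` (`F(b) − F(0) = φ`);
* §2 strength of the remainder: `stubOffFlat_iff_crux` — given `stub_invert` and `stub_descend`,
  `stub_offFlat ↔ OffTetraSectorKernel` (through the ideator's `off_iff_offFlat`), so the remainder is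
  exactly crux-strength (summit-implied, Disproof §1; a kill would be `¬KontsevichZagierPeriods`).
-/

noncomputable section

open Set MeasureTheory
open Literature.NumberTheory.Transcendental
open Literature.NumberTheory.Transcendental.KZ
open Summit.KontsevichZagierPeriods.KontsevichZagierPeriods.Cruxes.OffTetraSectorKernel.Ideator2
open Summit.KontsevichZagierPeriods.KontsevichZagierPeriods.Theses.HyperbolicBloch (OffTetraSectorKernel)

set_option linter.dupNamespace false

namespace Summit.KontsevichZagierPeriods.KontsevichZagierPeriods.Cruxes.OffTetraSectorKernel.DrefuteFlatShadow

/-! ## §1 Set identities behind `stub_invert` / `stub_descend` -/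


/-- The power polynomial `P(q₀,q₁) = Im z (q₀ − q₀² − q₁²) + (|z|² − Re z) q₁`. -/
def powPoly (z : ℂ) (x y : ℝ) : ℝ :=
  z.im * (x - x ^ 2 - y ^ 2) + (Complex.normSq z - z.re) * y

/-- The inverted solid `S z` of the stubs (verbatim clauses). -/
def invertedSolid (z : ℂ) : Set (Fin 3 → ℝ) :=
  {p | 0 < p 1 ∧ z.re * p 1 < z.im * p 0 ∧ z.im * (p 0 - 1) < (z.re - 1) * p 1 ∧ 0 < p 2 ∧
    (z.im * (p 0 - p 0 ^ 2 - p 1 ^ 2) + (Complex.normSq z - z.re) * p 1) * p 2 ^ 2 < z.im}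

/-- The inversion in the last coordinate. -/
def inv3 (p : Fin 3 → ℝ) : Fin 3 → ℝ := Function.update p 2 (p 2)⁻¹

@[simp] theorem inv3_zero (p : Fin 3 → ℝ) : inv3 p 0 = p 0 := by
  simp [inv3]
@[simp] theorem inv3_one (p : Fin 3 → ℝ) : inv3 p 1 = p 1 := by
  simp [inv3]
@[simp] theorem inv3_two (p : Fin 3 → ℝ) : inv3 p 2 = (p 2)⁻¹ := by
  simp [inv3]

theorem inv3_inv3 (p : Fin 3 → ℝ) : inv3 (inv3 p) = p := by
  ext i
  fin_cases i <;> simp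

theorem barycentric (z : ℂ) (x y : ℝ) :
    z.im * powPoly z x y =
      (z.im - z.im * x - (1 - z.re) * y) * (z.im * x - z.re * y) +
      Complex.normSq z * (z.im - z.im * x - (1 - z.re) * y) * y +
      ((1 - z.re) ^ 2 + z.im ^ 2) * (z.im * x - z.re * y) * y := by
  rw [powPoly, Complex.normSq_apply]; ring

/-- `P > 0` over the open triangle. -/
theorem powPoly_pos {z : ℂ} (him : 0 < z.im) {x y : ℝ} (h1 : 0 < y) (h2 : z.re * y < z.im * x)
    (h3 : z.im * (x - 1) < (z.re - 1) * y) : 0 < powPoly z x y := by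
  have hμ1 : 0 < z.im * x - z.re * y := by linarith
  have hμ0 : 0 < z.im - z.im * x - (1 - z.re) * y := by nlinarith
  have hN : 0 ≤ Complex.normSq z := Complex.normSq_nonneg z
  have hpos : 0 < z.im * powPoly z x y := by
    rw [barycentric]
    have t1 := mul_pos hμ0 hμ1
    have t2 : 0 ≤ Complex.normSq z * (z.im - z.im * x - (1 - z.re) * y) * y :=
      mul_nonneg (mul_nonneg hN hμ0.le) h1.le
    have t3 : 0 ≤ ((1 - z.re) ^ 2 + z.im ^ 2) * (z.im * x - z.re * y) * y :=
      mul_nonneg (mul_nonneg (by positivity) hμ1.le) h1.le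
    linarith
  by_contra hP
  push Not at hP
  nlinarith [mul_nonpos_of_nonneg_of_nonpos him.le hP]

/-- **`S z = Φ '' T(z)`**: the inverted solid is the image of the ideal tetrahedron under `t ↦ 1/t`
(the `r'.domain = Φ '' r.domain` clause of rule (2) for `stub_invert`). No hypothesis on `z`. -/
theorem invertedSolid_eq_image (z : ℂ) : invertedSolid z = inv3 '' idealTetrahedron z := by
  ext p
  constructor
  · rintro ⟨h1, h2, h3, h4, h5⟩
    refine ⟨inv3 p, ?_, inv3_inv3 p⟩
    refine ⟨by simpa using h1, by simpa using h2, by simpa using h3, by simpa using h4, ?_⟩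
    simp only [inv3_zero, inv3_one, inv3_two]
    have h4' : 0 < (p 2)⁻¹ := inv_pos.mpr h4
    have key : (p 2)⁻¹ ^ 2 * p 2 ^ 2 = 1 := by
      rw [← mul_pow, inv_mul_cancel₀ h4.ne', one_pow]
    nlinarith [mul_lt_mul_of_pos_left h5 (pow_pos h4' 2), key]
  · rintro ⟨q, ⟨h1, h2, h3, h4, h5⟩, rfl⟩
    refine ⟨by simpa using h1, by simpa using h2, by simpa using h3, by simpa using inv_pos.mpr h4, ?_⟩
    simp only [inv3_zero, inv3_one, inv3_two]
    have key : (q 2)⁻¹ ^ 2 * q 2 ^ 2 = 1 := by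
      rw [← mul_pow, inv_mul_cancel₀ h4.ne', one_pow]
    have hq2 : 0 < q 2 ^ 2 := pow_pos h4 2
    nlinarith [mul_lt_mul_of_pos_left h5 (pow_pos (inv_pos.mpr h4) 2), key]

/-- `inv3` is injective on `{t > 0}` (hence on `T(z)`): the `InjOn` clause of rule (2). -/
theorem injOn_inv3 (z : ℂ) : InjOn inv3 (idealTetrahedron z) := by
  intro p _ q _ h
  have := congrArg inv3 h
  rwa [inv3_inv3, inv3_inv3] at this

/-- **`S z` is the open band** `{(q, s) | q ∈ Δ z, 0 < s < (Im z / P(q))^{1/2}}` (for `Im z > 0`):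
the shape the Newton–Leibniz move of `stub_descend` needs, with a finite upper section. -/
theorem invertedSolid_eq_band {z : ℂ} (him : 0 < z.im) :
    invertedSolid z = {p | (0 < p 1 ∧ z.re * p 1 < z.im * p 0 ∧ z.im * (p 0 - 1) < (z.re - 1) * p 1) ∧
      0 < p 2 ∧ p 2 < Real.sqrt (z.im / powPoly z (p 0) (p 1))} := by
  ext p
  simp only [invertedSolid, mem_setOf_eq]
  constructor
  · rintro ⟨h1, h2, h3, h4, h5⟩
    have hP : 0 < powPoly z (p 0) (p 1) := powPoly_pos him h1 h2 h3
    refine ⟨⟨h1, h2, h3⟩, h4, ?_⟩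
    rw [Real.lt_sqrt h4.le, lt_div_iff₀ hP]
    simpa [powPoly, mul_comm] using h5
  · rintro ⟨⟨h1, h2, h3⟩, h4, h5⟩
    have hP : 0 < powPoly z (p 0) (p 1) := powPoly_pos him h1 h2 h3
    refine ⟨h1, h2, h3, h4, ?_⟩
    rw [Real.lt_sqrt h4.le, lt_div_iff₀ hP] at h5
    simpa [powPoly, mul_comm] using h5

/-- The Newton–Leibniz endpoint value: `F(b) − F(0) = b²/2 = Im z / (2 P)` = the flat density. -/
theorem half_sqrt_sq_eq_flatDensity {z : ℂ} (him : 0 < z.im) {x y : ℝ} (h1 : 0 < y)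
    (h2 : z.re * y < z.im * x) (h3 : z.im * (x - 1) < (z.re - 1) * y) :
    Real.sqrt (z.im / powPoly z x y) ^ 2 / 2 - 0 ^ 2 / 2 =
      z.im / (2 * (z.im * (x - x ^ 2 - y ^ 2) + (Complex.normSq z - z.re) * y)) := by
  have hP : 0 < powPoly z x y := powPoly_pos him h1 h2 h3
  rw [Real.sq_sqrt (div_pos him hP).le]
  simp only [powPoly] at hP ⊢
  field_simp
  ring


/-! ## §2 The remainder stub is exactly crux-strength -/


def stubInvertSig : Prop :=
  ∀ (S : ℂ → Set (Fin 3 → ℝ)), (∀ z, S z = {p | 0 < p 1 ∧ z.re * p 1 < z.im * p 0 ∧ z.im * (p 0 - 1) < (z.re - 1) * p 1 ∧ 0 < p 2 ∧ (z.im * (p 0 - p 0 ^ 2 - p 1 ^ 2) + (Complex.normSq z - z.re) * p 1) * p 2 ^ 2 < z.im}) → ∀ z : ℂ, IsAlgebraic ℚ z → 0 < z.im → ∀ r : Literature.NumberTheory.Transcendental.KZ.IntegralRep 3, r.domain = Literature.NumberTheory.Transcendental.idealTetrahedron z → Set.EqOn r.integrand (fun p => 1 / p 2 ^ 3) r.domain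 → (∃ m : Literature.NumberTheory.Transcendental.KZ.IntegralRep 3, m.domain = S z ∧ Set.EqOn m.integrand (fun p => p 2) m.domain) ∧ (∀ m : Literature.NumberTheory.Transcendental.KZ.IntegralRep 3, m.domain = S z → Set.EqOn m.integrand (fun p => p 2) m.domain → Literature.NumberTheory.Transcendental.KZ.Equivalent r m)

def stubDescendSig : Prop :=
  ∀ (S : ℂ → Set (Fin 3 → ℝ)), (∀ z, S z = {p | 0 < p 1 ∧ z.re * p 1 < z.im * p 0 ∧ z.im * (p 0 - 1) < (z.re - 1) * p 1 ∧ 0 < p 2 ∧ (z.im * (p 0 - p 0 ^ 2 - p 1 ^ 2) + (Complex.normSq z - z.re) * p 1) * p 2 ^ 2 < z.im}) → ∀ (Δ : ℂ → Set (Fin 2 → ℝ)), (∀ z, Δ z = {q | 0 < q 1 ∧ z.re * q 1 < z.im * q 0 ∧ z.im * (q 0 - 1) < (z.re - 1) * q 1}) → ∀ (φ : ℂ → (Fin 2 → ℝ) → ℝ), (∀ z q, φ z q = z.im / (2 * (z.im * (q 0 - q 0 ^ 2 - q 1 ^ 2) + (Complex.normSq z - z.re) * q 1))) → ∀ z : ℂ,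 IsAlgebraic ℚ z → 0 < z.im → ∀ m : Literature.NumberTheory.Transcendental.KZ.IntegralRep 3, m.domain = S z → Set.EqOn m.integrand (fun p => p 2) m.domain → (∃ s : Literature.NumberTheory.Transcendental.KZ.IntegralRep 2, s.domain = Δ z ∧ Set.EqOn s.integrand (φ z) s.domain) ∧ (∀ s : Literature.NumberTheory.Transcendental.KZ.IntegralRep 2, s.domain = Δ z → Set.EqOn s.integrand (φ z) s.domain → Literature.NumberTheory.Transcendental.KZ.Equivalent m s)

def stubOffflatSig : Prop :=
  ∀ (Δ : ℂ → Set (Fin 2 → ℝ)), (∀ z, Δ z = {q | 0 < q 1 ∧ z.re * q 1 < z.im * q 0 ∧ z.im * (q 0 - 1) < (z.re - 1) * q 1}) → ∀ (φ : ℂ → (Fin 2 → ℝ) → ℝ), (∀ z q, φ z q = z.im / (2 * (z.im * (q 0 - q 0 ^ 2 - q 1 ^ 2) + (Complex.normSq z - z.re) * q 1))) → ∀ c : Literature.NumberTheory.Transcendental.KZ.FormalRep, Literature.NumberTheory.Transcendental.KZ.eval c = 0 → c ∈ Literature.NumberTheory.Transcendental.KZ.relations ⊔ AddSubgroup.closure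 {d : Literature.NumberTheory.Transcendental.KZ.FormalRep | ∃ σ : ℂ → Literature.NumberTheory.Transcendental.KZ.IntegralRep 2, (∀ z, IsAlgebraic ℚ z → 0 < z.im → (σ z).domain = Δ z ∧ Set.EqOn (σ z).integrand (φ z) (Δ z)) ∧ ∃ (k : ℕ) (z : Fin k → ℂ) (n : Fin k → ℤ), (∀ i, IsAlgebraic ℚ (z i)) ∧ (∀ i, 0 < (z i).im) ∧ ∑ i, (n i : ℝ) * (σ (z i)).value = 0 ∧ d = ∑ i, n i • Literature.NumberTheory.Transcendental.KZ.of (σ (z i))}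

/-- The ideator's `flatTriangle` / `flatDensity` are the pinned `Δ` / `φ` of the stubs. -/
theorem flatTriangle_eq (z : ℂ) :
    flatTriangle z = {q | 0 < q 1 ∧ z.re * q 1 < z.im * q 0 ∧ z.im * (q 0 - 1) < (z.re - 1) * q 1} := rfl

theorem flatDensity_eq (z : ℂ) (q : Fin 2 → ℝ) :
    flatDensity z q = z.im / (2 * (z.im * (q 0 - q 0 ^ 2 - q 1 ^ 2) + (Complex.normSq z - z.re) * q 1)) := rfl

/-- `stub_offFlat` is verbatim the ideator's transfer `OffFlat`. -/
theorem stubOffFlat_iff_offFlat : stubOffflatSig ↔ OffFlat := by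
  constructor
  · intro h c hc
    exact h flatTriangle (fun _ => rfl) flatDensity (fun _ _ => rfl) c hc
  · intro h Δ hΔ φ hφ c hc
    obtain rfl : Δ = flatTriangle := funext hΔ
    obtain rfl : φ = flatDensity := funext fun z => funext (hφ z)
    exact h c hc

/-- The two transfer stubs give the ideator's first lemma `TetraFlatten`. -/
theorem tetraFlatten_of_stubs (h₁ : stubInvertSig) (h₂ : stubDescendSig) : TetraFlatten := by
  intro z hz him r s hr hri hs hsi
  set S : ℂ → Set (Fin 3 → ℝ) := fun z => {p | 0 < p 1 ∧ z.re * p 1 < z.im * p 0 ∧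
    z.im * (p 0 - 1) < (z.re - 1) * p 1 ∧ 0 < p 2 ∧
    (z.im * (p 0 - p 0 ^ 2 - p 1 ^ 2) + (Complex.normSq z - z.re) * p 1) * p 2 ^ 2 < z.im} with hS
  obtain ⟨⟨m, hm, hmi⟩, hall⟩ := h₁ S (fun _ => rfl) z hz him r hr hri
  obtain ⟨-, hall₂⟩ := h₂ S (fun _ => rfl) flatTriangle (fun _ => rfl) flatDensity (fun _ _ => rfl)
    z hz him m hm hmi
  exact (hall m hm hmi).trans (hall₂ s hs hsi)

/-- … and the two existence facts. -/
theorem tetraFamilyExists : TetraFamilyExists := by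
  classical
  refine ⟨fun z => if h : IsAlgebraic ℚ z ∧ 0 < z.im then idealTetrahedronRep z h.1 h.2
    else idealTetrahedronRep Complex.I KoblitzOgus.isAlgebraic_I (by simp), fun z hz him => ?_⟩
  simp only [dif_pos (And.intro hz him)]
  exact ⟨rfl, fun _ _ => rfl⟩

theorem flatFamilyExists_of_stubs (h₁ : stubInvertSig) (h₂ : stubDescendSig) : FlatFamilyExists := by
  classical
  set S : ℂ → Set (Fin 3 → ℝ) := fun z => {p | 0 < p 1 ∧ z.re * p 1 < z.im * p 0 ∧
    z.im * (p 0 - 1) < (z.re - 1) * p 1 ∧ 0 < p 2 ∧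
    (z.im * (p 0 - p 0 ^ 2 - p 1 ^ 2) + (Complex.normSq z - z.re) * p 1) * p 2 ^ 2 < z.im} with hS
  have hex : ∀ z, IsAlgebraic ℚ z → 0 < z.im →
      ∃ s : IntegralRep 2, s.domain = flatTriangle z ∧ EqOn s.integrand (flatDensity z) s.domain := by
    intro z hz him
    obtain ⟨⟨m, hm, hmi⟩, -⟩ := h₁ S (fun _ => rfl) z hz him (idealTetrahedronRep z hz him) rfl
      (fun _ _ => rfl)
    exact (h₂ S (fun _ => rfl) flatTriangle (fun _ => rfl) flatDensity (fun _ _ => rfl)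
      z hz him m hm hmi).1
  haveI : Nonempty (IntegralRep 2) := ⟨IntegralRep.empty 2⟩
  choose! σ hσ using hex
  refine ⟨fun z => if h : IsAlgebraic ℚ z ∧ 0 < z.im then σ z else σ Complex.I, fun z hz him => ?_⟩
  simp only [dif_pos (And.intro hz him)]
  obtain ⟨hd, hi⟩ := hσ z hz him
  exact ⟨hd, hd ▸ hi⟩

/-- **The remainder is exactly crux-strength.** Given the two transfer stubs, `stub_offFlat` is
EQUIVALENT to the crux `OffTetraSectorKernel` (via the ideator's kernel-checked `off_iff_offFlat`):
not refutable short of refuting the crux (hence the summit, Disproof §1), not provable short of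
proving it. -/
theorem stubOffFlat_iff_crux (h₁ : stubInvertSig) (h₂ : stubDescendSig) :
    stubOffflatSig ↔ OffTetraSectorKernel :=
  stubOffFlat_iff_offFlat.trans
    (off_iff_offFlat (tetraFlatten_of_stubs h₁ h₂) (flatFamilyExists_of_stubs h₁ h₂) tetraFamilyExists).symm


end Summit.KontsevichZagierPeriods.KontsevichZagierPeriods.Cruxes.OffTetraSectorKernel.DrefuteFlatShadow
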